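import Summits.BirchSwinnertonDyer.BirchSwinnertonDyer.Theorems.UniversalToricDescentDefectTransportModThreePTWallFree
import Summits.BirchSwinnertonDyer.BirchSwinnertonDyer.Theorems.UniversalToricDescentRationalCrossSqueeze
import HarnessLib

/-!
# The UTD parent's equality `Ch_Λ(X_{∅,0}(E/K_∞))·R₀⟦T⟧ = (𝓛)` from the RATIONAL wall (LEAD bsd-wall-utd-p1 g19, 2026-08-29;
# kernel-checked certificate for the parent node stmt-BirchSwinnertonDyer-20186 `ToricTransportModThree`, helper)

`charIdeal_map_eq_span_of_rationalWall_of_sigmaCongruence`: for the O6 wild curve `E` and a 3-congruent non-additive twin `E′`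
at a common Heegner field, in the binders of ♭T≤ `DefectTransportModThreePT` (Poitou–Tate DISCHARGED, wall and wild torsion
REMOVED): given A = `SigmaCongruenceAtThree` (hypothesis `hA`, research item 27120), base finiteness of `E` at `v ∣ 3`,
`Λ`-torsion of the twin's `X_{∅,0}(E′/K_∞)`, ONE twin frame `𝓛′` with the twin main conjecture `Ch·R₀⟦T⟧ = (𝓛′)` and
`μ(𝓛′) = 0`, and for the `E`-frame `𝓛` only the RATIONAL wall `∃ k, 3^k·𝓛 ∈ Ch_Λ(X_E)·R₀⟦T⟧`: then `Ch_Λ(X_E)·R₀⟦T⟧ = (𝓛)`.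
Proof = `…DefectTransportModThreePTWallFree.defectTransportPT_wallFree_of_sigmaCongruence_of_twinIMC` (one-sided transport
`n′ + m ≤ n + m′` with profiles, wall-free) + `…RationalCrossSqueeze.eq_span_of_rationalWall` (pure algebra).

WHAT THIS SAYS ABOUT THE ROUTE (for the pen; no route text is changed here): the parent 20186's conclusion at a frame `𝓛` needs
from the `E`-side ONLY the rational wall — the integral wall 20395's «slack-free» input is replaced by the twin's main conjecture
at one frame + `μ(𝓛′) = 0` (20400) + twin torsion + the wild base finiteness binder that ♭T≤ 23042 already carries. The rational
wall is what line `ratwall_thin_comb` on 20186 produces (`stub_ratCombSupply` research + `stub_noPseudoNull` print +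
`stub_ratDescent` ✓). HONEST FRAMING: conditional on A; closes nothing by itself; BSD is not proved by any of this.
References: [GreenbergVatsal2000] Thm. (1.4); [Washington1997] §7.1.
-/

noncomputable section

open scoped Classical

set_option linter.dupNamespace false
set_option autoImplicit false

namespace Summit.BirchSwinnertonDyer.BirchSwinnertonDyer.Theorems.UniversalToricDescentToricTransportModThreeOfRationalWall

open PowerSeries WeierstrassCurve NumberField IsDedekindDomain Field
  Literature.NumberTheory.EllipticCurves
  Literature.NumberTheory.EllipticCurves.ModularForms
  Literature.NumberTheory.EllipticCurves.Rank1Residual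
  Literature.NumberTheory.EllipticCurves.GreenbergSelmer
  Summit.BirchSwinnertonDyer.Rank1Residual Summit.BirchSwinnertonDyer.Rank1Residual.X11b
  Summit.BirchSwinnertonDyer.Rank1Residual.X11b.AcSelmer
  Summit.BirchSwinnertonDyer.BirchSwinnertonDyer.Theorems
  Summit.BirchSwinnertonDyer.BirchSwinnertonDyer.Theorems.SchneiderFree
  Summit.BirchSwinnertonDyer.BirchSwinnertonDyer.Theorems.UniversalToricDescentDefectTransportModThreePTWallFree
  Summit.BirchSwinnertonDyer.BirchSwinnertonDyer.Theorems.UniversalToricDescentRationalCrossSqueeze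

/-- **`Ch_Λ(X_{∅,0}(E/K_∞))·R₀⟦T⟧ = (𝓛)` from the rational wall**, the wall-free one-sided transport (given A) and the twin's
main conjecture at one frame with `μ = 0`. [cite: GreenbergVatsal2000, Thm. (1.4)] [cite: Washington1997, §7.1] -/
theorem charIdeal_map_eq_span_of_rationalWall_of_sigmaCongruence
    (hA : Summit.BirchSwinnertonDyer.BirchSwinnertonDyer.Theses.UniversalToricDescent.SigmaCongruenceAtThree) :
    ∀ (W : WeierstrassCurve ℚ) [W.IsElliptic] [W.IsGloballyMinimal] (W' : WeierstrassCurve ℚ) [W'.IsElliptic]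
      [W'.IsGloballyMinimal] (N N' : ℕ) [NeZero N] [NeZero N'] (K : Type) [Field K] [NumberField K]
      (Dt : ModularParametrizationData W N) (Dt' : ModularParametrizationData W' N'),
      Additive.ClassO6 W 3 → W.HasSurjectiveModNGaloisRep 3 → W.analyticRank = 1 → W.conductorNorm ℤ = N →
      O6.ModPCongruent W' W 3 → ¬ Addv W' 3 → W'.conductorNorm ℤ = N' → IsImaginaryQuadratic K →
      SatisfiesHeegnerHypothesis N K → SatisfiesHeegnerHypothesis N' K →
      (∀ v : HeightOneSpectrum (𝓞 K), ((3 : ℕ) : 𝓞 K) ∈ v.asIdeal → Finite (selmerAcBase (W.baseChange K) 3 v ∅)) →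
      ∀ (κ : ZpExtension K 3), κ.IsAnticyclotomic → ∀ (γ : absoluteGaloisGroup K) [Fact (κ.IsTopGenerator γ)]
      (𝔭 𝔭' : HeightOneSpectrum (𝓞 K)), ((3 : ℕ) : 𝓞 K) ∈ 𝔭.asIdeal → 𝔭.asIdeal.ramificationIdx (𝓞 ℚ) = 1 →
      𝔭.asIdeal.inertiaDeg (𝓞 ℚ) = 1 → ((3 : ℕ) : 𝓞 K) ∈ 𝔭'.asIdeal → 𝔭' ≠ 𝔭 →
      ∀ (ι' : PadicAlgCl 3 ≃+* ℂ), BranchInducesPrime 3 ι' 𝔭 →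
      Module.IsTorsion (IwasawaAlgebra 3) (XAc (W'.baseChange K) 3 κ 𝔭' ∅ γ) →
      ∀ (ΩK : ℂ) (Ωp : ℂ_[3]) (L : UnrSeries 3), ΩK ≠ 0 → Ωp ≠ 0 → IsBDPLFunction ι' 𝔭 κ γ Dt.f ΩK Ωp L →
      (∃ k : ℕ, ((3 : ℕ) : UnrSeries 3) ^ k * L ∈
        (XAc.charIdeal (W.baseChange K) 3 κ 𝔭' ∅ γ).map (PowerSeries.map (Halves.toUnr 3))) →
      ∀ (ΩK' : ℂ) (Ωp' : ℂ_[3]) (L' : UnrSeries 3), ΩK' ≠ 0 → Ωp' ≠ 0 → IsBDPLFunction ι' 𝔭 κ γ Dt'.f ΩK' Ωp' L' →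
      (XAc.charIdeal (W'.baseChange K) 3 κ 𝔭' ∅ γ).map (PowerSeries.map (Halves.toUnr 3)) = Ideal.span {L'} →
      (∃ i : ℕ, ‖((PowerSeries.coeff i L' : unrIntegers 3) : ℂ_[3])‖ = 1) →
      (XAc.charIdeal (W.baseChange K) 3 κ 𝔭' ∅ γ).map (PowerSeries.map (Halves.toUnr 3)) = Ideal.span {L} := by
  intro W _ _ W' _ _ N N' _ _ K _ _ Dt Dt' hO6 hsurj hr hN hcong hadd hN' hK hHe hHe' hfinE κ hκ γ _ 𝔭 𝔭' h𝔭 he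
    hf h𝔭' hne ι' hbr hT' ΩK Ωp L hΩK hΩp hL hrat ΩK' Ωp' L' hΩK' hΩp' hL' heq' hi'
  obtain ⟨g, g', n, m, n', m', hg, hg', hpg, hpL, hpg', hpL', hle⟩ :=
    defectTransportPT_wallFree_of_sigmaCongruence_of_twinIMC hA W W' N N' K Dt Dt' hO6 hsurj hr hN hcong hadd hN' hK
      hHe hHe' hfinE κ hκ γ 𝔭 𝔭' h𝔭 he hf h𝔭' hne ι' hbr hT' ΩK Ωp L hΩK hΩp hL ΩK' Ωp' L' hΩK' hΩp' hL' heq' hi'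
  obtain ⟨k, hk⟩ := hrat
  exact eq_span_of_rationalWall hg hpg hpL hpg' hpL' (hg'.symm.trans heq') hle hk

end Summit.BirchSwinnertonDyer.BirchSwinnertonDyer.Theorems.UniversalToricDescentToricTransportModThreeOfRationalWall

end
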